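import Summits.RiemannHypothesis.RiemannHypothesis.Theses.SignCone
import Literature.NumberTheory.LFunctions.WeilExplicit
import Literature.NumberTheory.LFunctions.WeilExplicitProofs
import Literature.NumberTheory.LFunctions.WeilMellinInversion
import Literature.NumberTheory.LFunctions.WeilMellinPolyDecay
import Literature.NumberTheory.LFunctions.EulerMaclaurinZeta
import Literature.NumberTheory.LFunctions.WeilArchimedeanPositivityProofs
import Literature.NumberTheory.LFunctions.WeilArchimedeanMoments
import Summits.RiemannHypothesis.RiemannHypothesis.Theorems.SignConeSignConeOscillatoryStubPolePairing
import Summits.RiemannHypothesis.RiemannHypothesis.Theorems.SignConeSignConeOscillatoryStubRemainderPairing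
import Summits.RiemannHypothesis.RiemannHypothesis.Theorems.SignConeSignConeOscillatoryStubZetaLineIntegrable
import Summits.RiemannHypothesis.RiemannHypothesis.Theorems.SignConeSignConeOscillatoryStubSpectralArchPolar
import Summits.RiemannHypothesis.RiemannHypothesis.Theorems.SignConeSignConeOscillatoryStubCombPairing
import Summits.RiemannHypothesis.RiemannHypothesis.Theorems.SignConeSignConeOscillatoryStubCertificateSuffices

/-!
# `SignConeOscillatory` from a spectral fake-zero certificate; the polar term on the critical line
(item stmt-RiemannHypothesis-16302, route route-RiemannHypothesis-SignCone, line `Sketch`)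

The sorry-free composition of the line `Cruxes/SignConeOscillatory/Lines/Sketch.lean` MINUS its terminal stub:

* `polarNodeZeta` — card A's first lemma (`Ideas/mellin-side-polar-transfer.md`, `PolarNodeZetaIdentity`), now a
  theorem: for a Weil test `F` with `tsupport F ⊆ (-∞, log N]`,
  `∫ F̂(1/2+iy) ζ(1/2+iy) dy = 2π Σ_{1 ≤ n ≤ N} F(log n)/√n − 2π F̂(1)` (Euler–Maclaurin `ν = 0` paired with `F̂`
  on the critical line: `riemannZeta_eq_eulerMaclaurin₀`, the landed stubs `stub_polePairing`,
  `stub_remainderPairing`, `stub_zetaLineIntegrable`, and `integral_weilMellin_vertical_mul_natCast_cpow`);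
* `spectralArchPolar` — the spectral form of the archimedean-plus-polar functional on an autocorrelation:
  `Re W_ar(g ⋆ g̃) + ‖g‖₂² = −(1/2π) ∫ |ĝ(1/2+iy)|² J_N(y) dy`,
  `J_N(y) = 2 Re(ζ − ζ_N)(1/2+iy) − Re ψ(1/4+iy/2) + log π − 1`, for `tsupport g ⊆ [-a, a]`, `e^{2a} ≤ N`;
* `signConeOscillatory_of_fakeZeroMeasure` — the crux `SignConeOscillatory` follows from the SPECTRAL FAKE-ZERO
  CERTIFICATE hypothesis (the line's terminal stub `stub_fakeZeroMeasure`, spelled out as the hypothesis; it is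
  RH-strength: RH-implied by the explicit formula with `(c, σ) = (Λ, dy/2π + Σ_ρ m_ρ δ_{Im ρ})`, and crux-implying
  here). This is a CONDITIONAL reduction, not a proof of the item.

`J_N` and the cosine comb are expanded verbatim (no local `def`).
-/

noncomputable section

-- `Summit.RiemannHypothesis.RiemannHypothesis.…` repeats a namespace component by design (D-0017 layout).
set_option linter.dupNamespace false

open scoped BigOperators ComplexConjugate Real
open Complex MeasureTheory Set Filter

namespace Summit.RiemannHypothesis.RiemannHypothesis.Theorems.SignConeOscillatory

open Literature.NumberTheory.LFunctions

/-- A continuous function whose topological support lies in `(-∞, L]` vanishes at `L`. -/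
theorem apply_eq_zero_of_tsupport_subset_Iic {F : ℝ → ℂ} (hF : Continuous F) {L : ℝ}
    (hsupp : tsupport F ⊆ Set.Iic L) : F L = 0 := by
  by_contra h
  have hopen : IsOpen {t : ℝ | F t ≠ 0} := isOpen_ne_fun hF continuous_const
  obtain ⟨ε, hε, hball⟩ := Metric.isOpen_iff.1 hopen L h
  have hmem : L + ε / 2 ∈ Metric.ball L ε := by
    rw [Metric.mem_ball, Real.dist_eq, add_sub_cancel_left, abs_of_pos (by positivity)]
    linarith
  have hne : F (L + ε / 2) ≠ 0 := hball hmem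
  have hle : L + ε / 2 ≤ L := hsupp (subset_tsupport _ (Function.mem_support.2 hne))
  linarith

/-- **Card A's first lemma (Euler–Maclaurin paired with `F̂`).** For a Weil test `F` with
`tsupport F ⊆ (-∞, log N]`, `N ≥ 1`:
`∫ F̂(1/2+iy) ζ(1/2+iy) dy = 2π Σ_{1 ≤ n ≤ N} F(log n)/√n − 2π F̂(1)` (the integrand is integrable).
Composition of `riemannZeta_eq_eulerMaclaurin₀` (`ν = 0`) with the node pairing
`integral_weilMellin_vertical_mul_natCast_cpow`, `stub_polePairing` and `stub_remainderPairing`;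
`F(log N) = 0` absorbs the `½ N^{-s}` term. -/
theorem polarNodeZeta (F : ℝ → ℂ) (N : ℕ) (hN : 1 ≤ N) (hF : IsWeilTest F)
    (hsupp : tsupport F ⊆ Set.Iic (Real.log N)) :
    Integrable (fun y : ℝ => weilMellin F (1 / 2 + y * I) * riemannZeta (1 / 2 + y * I)) ∧
    ∫ y : ℝ, weilMellin F (1 / 2 + y * I) * riemannZeta (1 / 2 + y * I)
      = 2 * π * (∑ n ∈ Finset.Icc 1 N, F (Real.log n) / (Real.sqrt n : ℂ))
        - 2 * π * weilMellin F 1 := by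
  refine ⟨stub_zetaLineIntegrable F hF, ?_⟩
  obtain ⟨hIp, hp⟩ := stub_polePairing F N hN hF hsupp
  obtain ⟨hIr, hr⟩ := stub_remainderPairing F N hN hF hsupp
  have hN0 : N ≠ 0 := by omega
  have hhalf : ((1 / 2 : ℝ) : ℂ) = 1 / 2 := by push_cast; ring
  -- Euler–Maclaurin of order zero on the critical line
  have hEM : ∀ y : ℝ, riemannZeta (1 / 2 + y * I) =
      ∑ n ∈ Finset.Ico 1 N, (n : ℂ) ^ (-(1 / 2 + y * I))
        + (N : ℂ) ^ (1 - (1 / 2 + y * I)) / ((1 / 2 + y * I) - 1)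
        + (N : ℂ) ^ (-(1 / 2 + y * I)) / 2
        - (1 / 2 + y * I) * bernoulliIntegral 1 N (1 / 2 + y * I) := by
    intro y
    refine riemannZeta_eq_eulerMaclaurin₀ hN (by simp) ?_
    intro h
    have := congrArg Complex.re h
    norm_num at this
  -- node terms
  have hnode : ∀ n : ℕ, n ≠ 0 →
      Integrable (fun y : ℝ => weilMellin F (1 / 2 + y * I) * (n : ℂ) ^ (-(1 / 2 + y * I))) ∧
      ∫ y : ℝ, weilMellin F (1 / 2 + y * I) * (n : ℂ) ^ (-(1 / 2 + y * I))
        = 2 * π * (F (Real.log n) / (Real.sqrt n : ℂ)) := by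
    intro n hn
    have hnpos : (0 : ℝ) < n := by exact_mod_cast Nat.pos_of_ne_zero hn
    constructor
    · have h := integrable_weilMellin_vertical_mul hF (1 / 2)
        (F := fun y : ℝ => (n : ℂ) ^ (-(1 / 2 + y * I))) ?_ (B := 1) ?_
      · simpa only [hhalf] using h
      · exact Continuous.const_cpow (by fun_prop) (Or.inl (by exact_mod_cast hn))
      · intro y
        rw [Complex.norm_natCast_cpow_of_pos (Nat.pos_of_ne_zero hn)]
        simp only [neg_re, add_re, one_div, inv_re, re_ofNat, normSq_ofNat, mul_re, ofReal_re, I_re,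
          mul_zero, ofReal_im, I_im, mul_one, sub_self, add_zero]
        exact Real.rpow_le_one_of_one_le_of_nonpos (by exact_mod_cast Nat.pos_of_ne_zero hn)
          (by norm_num)
    · have h := integral_weilMellin_vertical_mul_natCast_cpow hF (1 / 2) hn
      simpa only [hhalf] using h
  -- the finite node sum
  have hsumI : Integrable (fun y : ℝ => weilMellin F (1 / 2 + y * I) *
      ∑ n ∈ Finset.Ico 1 N, (n : ℂ) ^ (-(1 / 2 + y * I))) := by
    have : (fun y : ℝ => weilMellin F (1 / 2 + y * I) *
        ∑ n ∈ Finset.Ico 1 N, (n : ℂ) ^ (-(1 / 2 + y * I))) =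
        fun y : ℝ => ∑ n ∈ Finset.Ico 1 N, weilMellin F (1 / 2 + y * I) * (n : ℂ) ^ (-(1 / 2 + y * I)) := by
      funext y; rw [Finset.mul_sum]
    rw [this]
    refine integrable_finsetSum _ fun n hn => (hnode n ?_).1
    exact Nat.one_le_iff_ne_zero.1 (Finset.mem_Ico.1 hn).1
  have hsum : ∫ y : ℝ, weilMellin F (1 / 2 + y * I) *
      ∑ n ∈ Finset.Ico 1 N, (n : ℂ) ^ (-(1 / 2 + y * I))
        = 2 * π * ∑ n ∈ Finset.Ico 1 N, F (Real.log n) / (Real.sqrt n : ℂ) := by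
    have : (fun y : ℝ => weilMellin F (1 / 2 + y * I) *
        ∑ n ∈ Finset.Ico 1 N, (n : ℂ) ^ (-(1 / 2 + y * I))) =
        fun y : ℝ => ∑ n ∈ Finset.Ico 1 N, weilMellin F (1 / 2 + y * I) * (n : ℂ) ^ (-(1 / 2 + y * I)) := by
      funext y; rw [Finset.mul_sum]
    rw [this, integral_finsetSum _ fun n hn => (hnode n
      (Nat.one_le_iff_ne_zero.1 (Finset.mem_Ico.1 hn).1)).1, Finset.mul_sum]
    refine Finset.sum_congr rfl fun n hn => ?_
    rw [(hnode n (Nat.one_le_iff_ne_zero.1 (Finset.mem_Ico.1 hn).1)).2]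
  -- the `½ N^{-s}` term vanishes since `F(log N) = 0`
  have hFN : F (Real.log N) = 0 := apply_eq_zero_of_tsupport_subset_Iic hF.1.continuous hsupp
  have hNI : Integrable (fun y : ℝ => weilMellin F (1 / 2 + y * I) *
      ((N : ℂ) ^ (-(1 / 2 + y * I)) / 2)) := by
    have := ((hnode N hN0).1).div_const 2
    refine this.congr (Eventually.of_forall fun y => ?_)
    simp only [mul_div_assoc]
  have hNint : ∫ y : ℝ, weilMellin F (1 / 2 + y * I) * ((N : ℂ) ^ (-(1 / 2 + y * I)) / 2) = 0 := by
    have e : (fun y : ℝ => weilMellin F (1 / 2 + y * I) * ((N : ℂ) ^ (-(1 / 2 + y * I)) / 2)) =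
        fun y : ℝ => weilMellin F (1 / 2 + y * I) * (N : ℂ) ^ (-(1 / 2 + y * I)) / 2 := by
      funext y; ring
    rw [e, integral_div, (hnode N hN0).2, hFN]
    simp
  -- assemble
  have hsplit : (fun y : ℝ => weilMellin F (1 / 2 + y * I) * riemannZeta (1 / 2 + y * I)) =
      fun y : ℝ =>
        weilMellin F (1 / 2 + y * I) * ∑ n ∈ Finset.Ico 1 N, (n : ℂ) ^ (-(1 / 2 + y * I))
        + weilMellin F (1 / 2 + y * I) * ((N : ℂ) ^ (1 - (1 / 2 + y * I)) / ((1 / 2 + y * I) - 1))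
        + weilMellin F (1 / 2 + y * I) * ((N : ℂ) ^ (-(1 / 2 + y * I)) / 2)
        - weilMellin F (1 / 2 + y * I) * ((1 / 2 + y * I) * bernoulliIntegral 1 N (1 / 2 + y * I)) := by
    funext y
    rw [hEM y]
    ring
  have hI3 : Integrable (fun y : ℝ =>
      weilMellin F (1 / 2 + y * I) * ∑ n ∈ Finset.Ico 1 N, (n : ℂ) ^ (-(1 / 2 + y * I))
        + weilMellin F (1 / 2 + y * I) * ((N : ℂ) ^ (1 - (1 / 2 + y * I)) / ((1 / 2 + y * I) - 1))
        + weilMellin F (1 / 2 + y * I) * ((N : ℂ) ^ (-(1 / 2 + y * I)) / 2)) :=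
    (hsumI.add hIp).add hNI
  have hI2 : Integrable (fun y : ℝ =>
      weilMellin F (1 / 2 + y * I) * ∑ n ∈ Finset.Ico 1 N, (n : ℂ) ^ (-(1 / 2 + y * I))
        + weilMellin F (1 / 2 + y * I) * ((N : ℂ) ^ (1 - (1 / 2 + y * I)) / ((1 / 2 + y * I) - 1))) :=
    hsumI.add hIp
  rw [hsplit, integral_sub hI3 hIr, integral_add hI2 hNI, integral_add hsumI hIp, hsum, hp, hNint, hr]
  have hIcc : ∑ n ∈ Finset.Icc 1 N, F (Real.log n) / (Real.sqrt n : ℂ)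
      = ∑ n ∈ Finset.Ico 1 N, F (Real.log n) / (Real.sqrt n : ℂ) := by
    have e : Finset.Icc 1 N = Finset.Ico 1 (N + 1) := by
      ext n; simp only [Finset.mem_Icc, Finset.mem_Ico]; omega
    rw [e, Finset.sum_Ico_succ_top hN, hFN, zero_div, add_zero]
  rw [hIcc]
  ring

/-- REGISTERED FORM of `polarNodeZeta` (stub `stub_polarNodeZeta` of the line, uncurried signature). -/
theorem stub_polarNodeZeta : ∀ (F : ℝ → ℂ) (N : ℕ), 1 ≤ N → IsWeilTest F → tsupport F ⊆ Set.Iic (Real.log N) → Integrable (fun y : ℝ => weilMellin F (1 / 2 + y * I) * riemannZeta (1 / 2 + y * I)) ∧ ∫ y : ℝ, weilMellin F (1 / 2 + y * I) * riemannZeta (1 / 2 + y * I) = 2 * π * (∑ n ∈ Finset.Icc 1 N, F (Real.log n) / (Real.sqrt n : ℂ)) - 2 * π * weilMellin F 1 :=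
  fun F N hN hF hsupp => polarNodeZeta F N hN hF hsupp

/-- **Spectral form of `W_ar` on one autocorrelation** (composition of `polarNodeZeta` for `k = g ⋆ g̃`,
supported in `[-2a, 2a] ⊆ (-∞, log N]` when `e^{2a} ≤ N`, with `stub_spectralArchPolar`):
`Re W_ar(k) + ‖g‖₂² = -(1/2π) ∫ |ĝ(1/2+iy)|² J_N(y) dy`. -/
theorem spectralArchPolar (g : ℝ → ℂ) (hg : IsWeilTest g) {a : ℝ} (hsupp : tsupport g ⊆ Set.Icc (-a) a)
    {N : ℕ} (hNa : Real.exp (2 * a) ≤ N) :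
    (weilPolarTerm (weilConv g (weilReflect g)) + weilArchTerm (weilConv g (weilReflect g))).re
        + (∫ t : ℝ, ‖g t‖ ^ 2)
      = -(1 / (2 * π)) * ∫ y : ℝ, ‖weilMellin g (1 / 2 + y * I)‖ ^ 2 *
          (2 * (riemannZeta (1 / 2 + y * I)
                  - ∑ n ∈ Finset.Icc 1 N, (n : ℂ) ^ (-(1 / 2 + y * I))).re
            - (Complex.digamma (1 / 4 + y / 2 * I)).re + Real.log π - 1) := by
  have hNpos : (0 : ℝ) < N := (Real.exp_pos _).trans_le hNa
  have hN : 1 ≤ N := Nat.one_le_iff_ne_zero.2 (by rintro rfl; simp at hNpos)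
  have hk : IsWeilTest (weilConv g (weilReflect g)) := hg.weilConv hg.weilReflect
  have hk2a : tsupport (weilConv g (weilReflect g)) ⊆ Set.Icc (-(2 * a)) (2 * a) :=
    tsupport_weilConv_weilReflect_subset (a := a) hg.2 hsupp
  have h2a : 2 * a ≤ Real.log N := by
    rw [Real.le_log_iff_exp_le hNpos]
    exact hNa
  have hksupp : tsupport (weilConv g (weilReflect g)) ⊆ Set.Iic (Real.log N) :=
    fun t ht => ((Set.mem_Icc.1 (hk2a ht)).2).trans h2a
  obtain ⟨hI, hP⟩ := polarNodeZeta (weilConv g (weilReflect g)) N hN hk hksupp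
  exact stub_spectralArchPolar g N hN hg hI hP

/-- REGISTERED FORM of `spectralArchPolar` (stub `stub_spectralForm` of the line, uncurried signature). -/
theorem stub_spectralForm : ∀ (g : ℝ → ℂ) (a : ℝ) (N : ℕ), IsWeilTest g → tsupport g ⊆ Set.Icc (-a) a → Real.exp (2 * a) ≤ N → (weilPolarTerm (weilConv g (weilReflect g)) + weilArchTerm (weilConv g (weilReflect g))).re + (∫ t : ℝ, ‖g t‖ ^ 2) = -(1 / (2 * π)) * ∫ y : ℝ, ‖weilMellin g (1 / 2 + y * I)‖ ^ 2 * (2 * (riemannZeta (1 / 2 + y * I) - ∑ n ∈ Finset.Icc 1 N, (n : ℂ) ^ (-(1 / 2 + y * I))).re - (Complex.digamma (1 / 4 + y / 2 * I)).re + Real.log π - 1) :=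
  fun g _a _N hg hsupp hNa => spectralArchPolar g hg hsupp hNa

/-- **A `W_ar`-form certificate from a spectral one.** If `c`, `σ` satisfy the spectral certificate identity
`-(1/2π)∫|ĝ|² J_N − (1/2π)∫|ĝ|² comb_c = ∫ |ĝ|² dσ` for the Weil tests `g` supported in `[-a, a]` (`e^{2a} ≤ N`),
then `Re W_ar(g ⋆ g̃) + ‖g‖₂² − P_c(g ⋆ g̃) = ∫ |ĝ(1/2+iy)|² dσ` for the same `g`
(`spectralArchPolar` + `stub_combPairing`). -/
theorem certificate_of_spectralCertificate {a : ℝ} {N : ℕ} (hNa : Real.exp (2 * a) ≤ N) (c : ℕ → ℝ)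
    (σ : Measure ℝ)
    (hσ : ∀ g : ℝ → ℂ, IsWeilTest g → tsupport g ⊆ Set.Icc (-a) a →
        -(1 / (2 * π)) * (∫ y : ℝ, ‖weilMellin g (1 / 2 + y * I)‖ ^ 2 *
            (2 * (riemannZeta (1 / 2 + y * I)
                    - ∑ n ∈ Finset.Icc 1 N, (n : ℂ) ^ (-(1 / 2 + y * I))).re
              - (Complex.digamma (1 / 4 + y / 2 * I)).re + Real.log π - 1))
          - 1 / (2 * π) * (∫ y : ℝ, ‖weilMellin g (1 / 2 + y * I)‖ ^ 2 *
              ∑ n ∈ Finset.Icc 2 N, c n * (2 * Real.cos (y * Real.log n)) / Real.sqrt n)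
          = ∫ y : ℝ, ‖weilMellin g (1 / 2 + y * I)‖ ^ 2 ∂σ)
    (g : ℝ → ℂ) (hg : IsWeilTest g) (hsupp : tsupport g ⊆ Set.Icc (-a) a) :
    (weilPolarTerm (weilConv g (weilReflect g)) + weilArchTerm (weilConv g (weilReflect g))).re
        + (∫ t : ℝ, ‖g t‖ ^ 2)
        - ∑ n ∈ Finset.Icc 2 N, c n * (2 * (weilConv g (weilReflect g) (Real.log n)).re) / Real.sqrt n
      = ∫ y : ℝ, ‖weilMellin g (1 / 2 + y * I)‖ ^ 2 ∂σ := by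
  rw [spectralArchPolar g hg hsupp hNa, ← (stub_combPairing g N c hg).2, ← hσ g hg hsupp]

open Summit.RiemannHypothesis.RiemannHypothesis.Theses.SignCone in
/-- **The crux from a spectral fake-zero certificate at every cutoff** (conditional reduction; the hypothesis is
the line's terminal, RH-strength stub `stub_fakeZeroMeasure` verbatim): if for every `a > 0` there are
`N ≥ e^{2a}`, a non-negative weight `c` and a positive measure `σ` on the critical line with
`-(1/2π)∫|ĝ|² J_N − (1/2π)∫|ĝ|² comb_c = ∫ |ĝ|² dσ` for all Weil tests `g` supported in `[-a, a]`, then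
`SignConeOscillatory` (via `certificate_of_spectralCertificate` and `stub_certificateSuffices`; the item's
`M`-form is definitionally `-(F 0).re ≤ (weilPolarTerm F + weilArchTerm F).re`). -/
theorem signConeOscillatory_of_fakeZeroMeasure
    (h : ∀ a : ℝ, 0 < a → ∃ N : ℕ, Real.exp (2 * a) ≤ N ∧ ∃ c : ℕ → ℝ, (∀ n, 0 ≤ c n) ∧
      ∃ σ : Measure ℝ, ∀ g : ℝ → ℂ, IsWeilTest g → tsupport g ⊆ Set.Icc (-a) a →
        Integrable (fun y : ℝ => ‖weilMellin g (1 / 2 + y * I)‖ ^ 2) σ ∧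
        -(1 / (2 * π)) * (∫ y : ℝ, ‖weilMellin g (1 / 2 + y * I)‖ ^ 2 *
            (2 * (riemannZeta (1 / 2 + y * I)
                    - ∑ n ∈ Finset.Icc 1 N, (n : ℂ) ^ (-(1 / 2 + y * I))).re
              - (Complex.digamma (1 / 4 + y / 2 * I)).re + Real.log π - 1))
          - 1 / (2 * π) * (∫ y : ℝ, ‖weilMellin g (1 / 2 + y * I)‖ ^ 2 *
              ∑ n ∈ Finset.Icc 2 N, c n * (2 * Real.cos (y * Real.log n)) / Real.sqrt n)
          = ∫ y : ℝ, ‖weilMellin g (1 / 2 + y * I)‖ ^ 2 ∂σ) :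
    SignConeOscillatory := by
  intro a ha k g hg F hn _hosc M
  obtain ⟨N, hNa, c, hc, σ, hσ⟩ := h a ha
  have hgi : ∀ i, IsWeilTest (g i) := fun i => (hg i).1
  show -(F 0).re ≤ (weilPolarTerm F + weilArchTerm F).re
  exact stub_certificateSuffices N c σ k g hc hgi
    (fun i => certificate_of_spectralCertificate hNa c σ (fun g' hg' hs' => (hσ g' hg' hs').2)
      (g i) (hgi i) (hg i).2) hn

/-- REGISTERED FORM of `signConeOscillatory_of_fakeZeroMeasure` (stub `stub_reduction` of the line): the crux is
CLOSED MODULO the terminal stub `stub_fakeZeroMeasure` (RH-strength), kernel-checked. -/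
theorem stub_reduction : (∀ a : ℝ, 0 < a → ∃ N : ℕ, Real.exp (2 * a) ≤ N ∧ ∃ c : ℕ → ℝ, (∀ n, 0 ≤ c n) ∧ ∃ σ : Measure ℝ, ∀ g : ℝ → ℂ, IsWeilTest g → tsupport g ⊆ Set.Icc (-a) a → Integrable (fun y : ℝ => ‖weilMellin g (1 / 2 + y * I)‖ ^ 2) σ ∧ -(1 / (2 * π)) * (∫ y : ℝ, ‖weilMellin g (1 / 2 + y * I)‖ ^ 2 * (2 * (riemannZeta (1 / 2 + y * I) - ∑ n ∈ Finset.Icc 1 N, (n : ℂ) ^ (-(1 / 2 + y * I))).re - (Complex.digamma (1 / 4 + y / 2 * I)).re + Real.log π - 1)) - 1 / (2 * π) * (∫ y : ℝ, ‖weilMellin g (1 / 2 + y * I)‖ ^ 2 * ∑ n ∈ Finset.Icc 2 N, c n * (2 * Real.cos (y * Real.log n)) / Real.sqrt n) = ∫ y : ℝ, ‖weilMellin g (1 / 2 + y * I)‖ ^ 2 ∂σ) → Summit.RiemannHypothesis.RiemannHypothesis.Theses.SignCone.SignConeOscillatory :=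
  fun h => signConeOscillatory_of_fakeZeroMeasure h

end Summit.RiemannHypothesis.RiemannHypothesis.Theorems.SignConeOscillatory

end
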